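import Mathlib
import Summits.NavierStokesRegularity.NavierStokesRegularity.Theorems.TaoLadderRungTwoBreakBlowupRigidityOneClockedFrontExtraction
import HarnessLib

/-!
# Closure of the renormalised inviscid eternal law under an additive perturbation vanishing locally uniformly — the
  ODE-closure step of the extraction from a VISCOUS clocked front for K2(1) `TaoLadderRungTwoBreak.BlowupRigidityOne`
  (stmt-NavierStokesRegularity-20206)

MODEL lattice ODEs only (Tao 2016 §4 (4.8), the viscous equation before Thm. 4.2, §6.4); nothing here is a statement about
the Navier–Stokes equations; NO item is closed (`--supports stmt-NavierStokesRegularity-20206`). Route-independent (general `m`).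

Along a `ν`-viscous flow the firing-centred renormalised translates obey the inviscid eternal law plus the covariant damping
`-c_j(n,u) V_j(n,u)`, `c_j(n,u) = ν(1+ε₀)^{2n}e^{-u}·[(1+ε₀)^{2j}(T-τ_j)]`, and at a strictly (S₁)-surviving front the bracket
dies geometrically in `j` (companion file `…ViscousFrontExtraction`). This file is the closure lemma in the generality needed:

* `perturbedLaw_of_continuousLimit_local` — laws `V_j' = -V_j + Q + ΛA + Λ⁻¹B + P_j` on `(a_j, ∞)`, `a_j → -∞`, `P_j(n,·)`
  continuous there with `‖P_j(n,u)‖ ≤ e` on `[a',∞)` eventually in `j` (every `e > 0`), local half-line bounds, continuous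
  convergence ⇒ the limit solves the UNPERTURBED law of `IsEternal ε₀ α` at every `σ` (same scheme as
  `eternalLaw_of_continuousLimit_local`: integral form + dominated convergence + FTC).

HONEST LABEL: a compactness lemma; no stub, crux or summit is proved here.
-/

noncomputable section

-- the summit and its single sub-problem share the name (CONVENTIONS §1)
set_option linter.dupNamespace false

open Set Filter Topology MeasureTheory

namespace Summit.NavierStokesRegularity.NavierStokesRegularity.Theorems

namespace BlowupRigidityOne

open Literature.Analysis.FluidPDE Literature.Analysis.FluidPDE.TaoCascade
open Summit.NavierStokesRegularity.NavierStokesRegularity.Cruxes.MinimalBlowupExtraction.Extraction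
  (exists_subseq_continuousLimit)
open Summit.NavierStokesRegularity.NavierStokesRegularity.Cruxes.MinimalBlowupExtraction.TableCont
  (tendsto_tableQ_comp tendsto_tableA_comp tendsto_tableB_comp)
open TransitMassLedgerEnergy (continuous_tableQ continuous_tableA continuous_tableB_comp)

variable {m : ℕ}

/-- **LOCAL CLOSURE OF THE INVISCID ETERNAL LAW UP TO A VANISHING PERTURBATION.** Let `V_j : ℤ → ℝ → ℝ^m` satisfy, at
every `u > a_j` (`a_j → -∞`), the law of `IsEternal ε₀ α` plus an additive perturbation `P_j(n,u)` that is continuous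
there and VANISHES LOCALLY UNIFORMLY: for every shell `n`, every `a'` and every `e > 0`, `‖P_j(n,u)‖ ≤ e` on `[a',∞)`
eventually in `j`. Suppose some bound `‖V_j n u‖ ≤ B` holds on `[a',∞)` eventually in `j` (every `n`, `a'`). If the `V_j`
converge continuously to `W`, then `W` satisfies the UNPERTURBED law of `IsEternal ε₀ α` at every `σ ∈ ℝ`. (The case of
this file: `P_j(n,u) = -c_j(n,u) V_j(n,u)` with a covariant viscosity coefficient `c_j → 0`.)
[cite: Tao2016AveragedNS, §4 Lemma 4.1 (iii) (4.8) and the viscous equation before Thm. 4.2, in the variables of §6.4; Teschl2012, §2.6 (continuous dependence / passage to the limit in the integral form); cell vocabulary (`IsEternal`)] -/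
theorem perturbedLaw_of_continuousLimit_local {ε₀ : ℝ} {α : Fin m → Fin m → Fin m → ℤ × ℤ × ℤ → ℝ}
    {V P : ℕ → ℤ → ℝ → Em m} {a : ℕ → ℝ}
    (hlaw : ∀ (j : ℕ) (n : ℤ) (u : ℝ), a j < u → HasDerivAt (V j n)
      (-((1 : ℝ) • V j n u) + tableQ α (V j n u) + bigLam ε₀ • tableA α (V j (n - 1) u)
        + (bigLam ε₀)⁻¹ • tableB α (V j (n + 1) u) (V j n u) + P j n u) u)
    (hPcont : ∀ (j : ℕ) (n : ℤ) (u : ℝ), a j < u → ContinuousAt (P j n) u)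
    (hP : ∀ (n : ℤ) (a' e : ℝ), 0 < e → ∀ᶠ j in atTop, ∀ u : ℝ, a' ≤ u → ‖P j n u‖ ≤ e)
    (hbd : ∀ (n : ℤ) (a' : ℝ), ∃ B : ℝ, ∀ᶠ j in atTop, ∀ u : ℝ, a' ≤ u → ‖V j n u‖ ≤ B)
    (ha : Tendsto a atTop atBot) {W : ℤ → ℝ → Em m}
    (hconv : ∀ (n : ℤ) (u : ℕ → ℝ) (σ : ℝ), Tendsto u atTop (𝓝 σ) →
      Tendsto (fun j => V j n (u j)) atTop (𝓝 (W n σ)))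
    (n : ℤ) (σ : ℝ) :
    HasDerivAt (W n) (-((1 : ℝ) • W n σ) + tableQ α (W n σ) + bigLam ε₀ • tableA α (W (n - 1) σ)
        + (bigLam ε₀)⁻¹ • tableB α (W (n + 1) σ) (W n σ)) σ := by
  -- pointwise limits (constant sequences)
  have hpt : ∀ (k : ℤ) (u : ℝ), Tendsto (fun j => V j k u) atTop (𝓝 (W k u)) := fun k u =>
    hconv k (fun _ => u) u tendsto_const_nhds
  -- the perturbation dies pointwise
  have hP0 : ∀ (k : ℤ) (u : ℝ), Tendsto (fun j => P j k u) atTop (𝓝 0) := by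
    intro k u
    refine Metric.tendsto_nhds.2 fun e he => ?_
    refine (hP k u (e / 2) (half_pos he)).mono fun j hj => ?_
    rw [dist_zero_right]
    exact lt_of_le_of_lt (hj u le_rfl) (half_lt_self he)
  -- LOCAL bounds: on `[a', ∞)`, eventually, shells `k, k±1` and the perturbed field at shell `k` are bounded by one `K`
  have hloc : ∀ (k : ℤ) (a' : ℝ), ∃ K : ℝ, 0 ≤ K ∧ ∀ᶠ j in atTop, a j < a' ∧ ∀ u : ℝ, a' ≤ u →
      ‖V j k u‖ ≤ K ∧
      ‖-((1 : ℝ) • V j k u) + tableQ α (V j k u) + bigLam ε₀ • tableA α (V j (k - 1) u)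
        + (bigLam ε₀)⁻¹ • tableB α (V j (k + 1) u) (V j k u) + P j k u‖ ≤ K := by
    intro k a'
    obtain ⟨B₀, h₀⟩ := hbd k a'
    obtain ⟨B₁, h₁⟩ := hbd (k - 1) a'
    obtain ⟨B₂, h₂⟩ := hbd (k + 1) a'
    set Bm : ℝ := max (max B₀ B₁) (max B₂ 0) with hBm
    have hB0 : B₀ ≤ Bm := (le_max_left _ _).trans (le_max_left _ _)
    have hB1 : B₁ ≤ Bm := (le_max_right _ _).trans (le_max_left _ _)
    have hB2 : B₂ ≤ Bm := (le_max_left _ _).trans (le_max_right _ _)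
    have hBm0 : 0 ≤ Bm := (le_max_right _ _).trans (le_max_right _ _)
    set K : ℝ := Bm + shiftConst α (0, 0, 0) * Bm ^ 2 + ‖bigLam ε₀‖ * (shiftConst α (0, 0, 1) * Bm ^ 2)
      + ‖(bigLam ε₀)⁻¹‖ * ((shiftConst α (1, 0, 0) + shiftConst α (0, 1, 0)) * Bm * Bm) + 1 with hK
    have hBK : Bm ≤ K := by
      have h1 : 0 ≤ shiftConst α (0, 0, 0) * Bm ^ 2 := mul_nonneg (shiftConst_nonneg α _) (sq_nonneg _)
      have h2 : 0 ≤ ‖bigLam ε₀‖ * (shiftConst α (0, 0, 1) * Bm ^ 2) :=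
        mul_nonneg (norm_nonneg _) (mul_nonneg (shiftConst_nonneg α _) (sq_nonneg _))
      have h3 : 0 ≤ ‖(bigLam ε₀)⁻¹‖ * ((shiftConst α (1, 0, 0) + shiftConst α (0, 1, 0)) * Bm * Bm) :=
        mul_nonneg (norm_nonneg _) (mul_nonneg (mul_nonneg
          (add_nonneg (shiftConst_nonneg α _) (shiftConst_nonneg α _)) hBm0) hBm0)
      rw [hK]; linarith
    refine ⟨K, hBm0.trans hBK, ?_⟩
    filter_upwards [h₀, h₁, h₂, ha.eventually (eventually_lt_atBot a'), hP k a' 1 one_pos]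
      with j hj₀ hj₁ hj₂ hja hjP
    refine ⟨hja, fun u hu => ⟨(hj₀ u hu).trans (hB0.trans hBK), ?_⟩⟩
    have hmain := norm_eternalLaw_rhs_le ε₀ α hBm0 ((hj₀ u hu).trans hB0) ((hj₁ u hu).trans hB1)
      ((hj₂ u hu).trans hB2)
    calc ‖-((1 : ℝ) • V j k u) + tableQ α (V j k u) + bigLam ε₀ • tableA α (V j (k - 1) u)
          + (bigLam ε₀)⁻¹ • tableB α (V j (k + 1) u) (V j k u) + P j k u‖
        ≤ ‖-((1 : ℝ) • V j k u) + tableQ α (V j k u) + bigLam ε₀ • tableA α (V j (k - 1) u)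
          + (bigLam ε₀)⁻¹ • tableB α (V j (k + 1) u) (V j k u)‖ + ‖P j k u‖ := norm_add_le _ _
      _ ≤ (Bm + shiftConst α (0, 0, 0) * Bm ^ 2 + ‖bigLam ε₀‖ * (shiftConst α (0, 0, 1) * Bm ^ 2)
          + ‖(bigLam ε₀)⁻¹‖ * ((shiftConst α (1, 0, 0) + shiftConst α (0, 1, 0)) * Bm * Bm)) + 1 :=
          add_le_add hmain (hjP u hu)
      _ = K := by rw [hK]
  -- eventually, each `V j k` is `K`-Lipschitz on `[a', ∞)`
  have hlipV : ∀ (k : ℤ) (a' : ℝ), ∃ K : ℝ, 0 ≤ K ∧ ∀ᶠ j in atTop, ∀ u v : ℝ, a' ≤ u → u ≤ v →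
      ‖V j k v - V j k u‖ ≤ K * (v - u) := by
    intro k a'
    obtain ⟨K, hK0, hev⟩ := hloc k a'
    refine ⟨K, hK0, hev.mono fun j hj u v hu huv => ?_⟩
    obtain ⟨hja, hj⟩ := hj
    have hderiv : ∀ τ ∈ Icc u v, HasDerivWithinAt (V j k)
        (-((1 : ℝ) • V j k τ) + tableQ α (V j k τ) + bigLam ε₀ • tableA α (V j (k - 1) τ)
          + (bigLam ε₀)⁻¹ • tableB α (V j (k + 1) τ) (V j k τ) + P j k τ) (Icc u v) τ := fun τ hτ =>
      (hlaw j k τ (by linarith [hτ.1])).hasDerivWithinAt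
    have hbound : ∀ τ ∈ Ico u v,
        ‖-((1 : ℝ) • V j k τ) + tableQ α (V j k τ) + bigLam ε₀ • tableA α (V j (k - 1) τ)
          + (bigLam ε₀)⁻¹ • tableB α (V j (k + 1) τ) (V j k τ) + P j k τ‖ ≤ K := fun τ hτ =>
      (hj τ (hu.trans hτ.1)).2
    exact norm_image_sub_le_of_norm_deriv_le_segment' hderiv hbound v (right_mem_Icc.2 huv)
  -- hence `W k` is Lipschitz on every half-line, in particular continuous
  have hlipW : ∀ (k : ℤ) (a' : ℝ), ∃ K : ℝ, 0 ≤ K ∧ ∀ u v : ℝ, a' ≤ u → u ≤ v →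
      ‖W k v - W k u‖ ≤ K * (v - u) := by
    intro k a'
    obtain ⟨K, hK0, hev⟩ := hlipV k a'
    exact ⟨K, hK0, fun u v hu huv =>
      le_of_tendsto ((hpt k v).sub (hpt k u)).norm (hev.mono fun j hj => hj u v hu huv)⟩
  have hWcont : ∀ k : ℤ, Continuous (W k) := by
    intro k
    refine continuous_iff_continuousAt.2 fun σ₀ => ?_
    obtain ⟨K, hK0, hK⟩ := hlipW k (σ₀ - 1)
    have hL : LipschitzOnWith K.toNNReal (W k) (Ici (σ₀ - 1)) := by
      refine LipschitzOnWith.of_dist_le' fun x hx y hy => ?_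
      rw [dist_eq_norm, Real.dist_eq]
      rcases le_total x y with hxy | hxy
      · rw [norm_sub_rev, abs_sub_comm, abs_of_nonneg (by linarith)]
        exact hK x y hx hxy
      · rw [abs_of_nonneg (by linarith)]
        exact hK y x hy hxy
    exact hL.continuousOn.continuousAt (Ici_mem_nhds (by linarith))
  -- the limiting field is continuous
  have hΦ : Continuous (fun u => -((1 : ℝ) • W n u) + tableQ α (W n u)
      + bigLam ε₀ • tableA α (W (n - 1) u) + (bigLam ε₀)⁻¹ • tableB α (W (n + 1) u) (W n u)) := by
    have hQ : Continuous (fun u => tableQ α (W n u)) := (continuous_tableQ α).comp (hWcont n)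
    have hA : Continuous (fun u => tableA α (W (n - 1) u)) := (continuous_tableA α).comp (hWcont (n - 1))
    have hBB : Continuous (fun u => tableB α (W (n + 1) u) (W n u)) :=
      continuous_tableB_comp α (hWcont (n + 1)) (hWcont n)
    refine Continuous.add (Continuous.add (Continuous.add ?_ hQ) ?_) ?_
    · exact Continuous.neg (Continuous.const_smul (hWcont n) (1 : ℝ))
    · exact Continuous.const_smul hA (bigLam ε₀)
    · exact Continuous.const_smul hBB ((bigLam ε₀)⁻¹)
  -- the perturbed fields along `V j` are continuous on `(a j, ∞)`
  have hcontV : ∀ (j : ℕ) (k : ℤ) (u : ℝ), a j < u → ContinuousAt (V j k) u := fun j k u hu =>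
    (hlaw j k u hu).continuousAt
  have hcontF : ∀ (j : ℕ) (u : ℝ), a j < u → ContinuousAt (fun v => -((1 : ℝ) • V j n v)
      + tableQ α (V j n v) + bigLam ε₀ • tableA α (V j (n - 1) v)
      + (bigLam ε₀)⁻¹ • tableB α (V j (n + 1) v) (V j n v) + P j n v) u := by
    intro j u hu
    have hQ : ContinuousAt (fun v => tableQ α (V j n v)) u := tendsto_tableQ_comp α (hcontV j n u hu)
    have hA : ContinuousAt (fun v => tableA α (V j (n - 1) v)) u :=
      tendsto_tableA_comp α (hcontV j (n - 1) u hu)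
    have hBB : ContinuousAt (fun v => tableB α (V j (n + 1) v) (V j n v)) u :=
      tendsto_tableB_comp α (hcontV j (n + 1) u hu) (hcontV j n u hu)
    refine ContinuousAt.add (ContinuousAt.add (ContinuousAt.add (ContinuousAt.add ?_ hQ) ?_) ?_)
      (hPcont j n u hu)
    · exact ContinuousAt.neg (ContinuousAt.const_smul (hcontV j n u hu) (1 : ℝ))
    · exact ContinuousAt.const_smul hA (bigLam ε₀)
    · exact ContinuousAt.const_smul hBB ((bigLam ε₀)⁻¹)
  -- pointwise convergence of the perturbed fields to the unperturbed limiting field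
  have hFlim : ∀ u : ℝ, Tendsto (fun j => -((1 : ℝ) • V j n u) + tableQ α (V j n u)
      + bigLam ε₀ • tableA α (V j (n - 1) u) + (bigLam ε₀)⁻¹ • tableB α (V j (n + 1) u) (V j n u)
      + P j n u) atTop
      (𝓝 (-((1 : ℝ) • W n u) + tableQ α (W n u) + bigLam ε₀ • tableA α (W (n - 1) u)
        + (bigLam ε₀)⁻¹ • tableB α (W (n + 1) u) (W n u))) := by
    intro u
    have hQ := tendsto_tableQ_comp α (hpt n u)
    have hA := tendsto_tableA_comp α (hpt (n - 1) u)
    have hBB := tendsto_tableB_comp α (hpt (n + 1) u) (hpt n u)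
    rw [← add_zero (-((1 : ℝ) • W n u) + tableQ α (W n u) + bigLam ε₀ • tableA α (W (n - 1) u)
        + (bigLam ε₀)⁻¹ • tableB α (W (n + 1) u) (W n u))]
    refine Tendsto.add (Tendsto.add (Tendsto.add (Tendsto.add ?_ hQ) ?_) ?_) (hP0 n u)
    · exact Tendsto.neg (Tendsto.const_smul (hpt n u) (1 : ℝ))
    · exact Tendsto.const_smul hA (bigLam ε₀)
    · exact Tendsto.const_smul hBB ((bigLam ε₀)⁻¹)
  -- integral form in the limit
  have hint : ∀ σ₀ σ' : ℝ, σ₀ ≤ σ' →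
      ∫ u in σ₀..σ', (-((1 : ℝ) • W n u) + tableQ α (W n u) + bigLam ε₀ • tableA α (W (n - 1) u)
        + (bigLam ε₀)⁻¹ • tableB α (W (n + 1) u) (W n u)) = W n σ' - W n σ₀ := by
    intro σ₀ σ' hle
    obtain ⟨K, hK0, hev⟩ := hloc n σ₀
    -- the integral form of each `V j`, eventually
    have hframe : ∀ᶠ j in atTop,
        ∫ u in σ₀..σ', (-((1 : ℝ) • V j n u) + tableQ α (V j n u) + bigLam ε₀ • tableA α (V j (n - 1) u)
          + (bigLam ε₀)⁻¹ • tableB α (V j (n + 1) u) (V j n u) + P j n u) = V j n σ' - V j n σ₀ := by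
      refine hev.mono fun j hj => ?_
      obtain ⟨hja, -⟩ := hj
      refine intervalIntegral.integral_eq_sub_of_hasDerivAt (fun u hu => ?_) ?_
      · rw [uIcc_of_le hle] at hu
        exact hlaw j n u (lt_of_lt_of_le hja hu.1)
      · refine ContinuousOn.intervalIntegrable ?_
        rw [uIcc_of_le hle]
        exact fun u hu => (hcontF j u (lt_of_lt_of_le hja hu.1)).continuousWithinAt
    -- dominated convergence of the fields
    have hlim : Tendsto (fun j => ∫ u in σ₀..σ', (-((1 : ℝ) • V j n u) + tableQ α (V j n u)
        + bigLam ε₀ • tableA α (V j (n - 1) u) + (bigLam ε₀)⁻¹ • tableB α (V j (n + 1) u) (V j n u)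
        + P j n u)) atTop
        (𝓝 (∫ u in σ₀..σ', (-((1 : ℝ) • W n u) + tableQ α (W n u) + bigLam ε₀ • tableA α (W (n - 1) u)
          + (bigLam ε₀)⁻¹ • tableB α (W (n + 1) u) (W n u)))) := by
      refine intervalIntegral.tendsto_integral_filter_of_dominated_convergence (fun _ => K)
        ?_ ?_ intervalIntegrable_const ?_
      · refine hev.mono fun j hj => ContinuousOn.aestronglyMeasurable (fun u hu => ?_) measurableSet_uIoc
        rw [Set.uIoc_of_le hle] at hu
        exact (hcontF j u (lt_trans hj.1 hu.1)).continuousWithinAt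
      · refine hev.mono fun j hj => ae_of_all _ fun u hu => ?_
        rw [Set.uIoc_of_le hle] at hu
        exact (hj.2 u hu.1.le).2
      · exact ae_of_all _ fun u _ => hFlim u
    exact tendsto_nhds_unique (hlim.congr' hframe) ((hpt n σ').sub (hpt n σ₀))
  -- FTC-2 at `σ`, from the base point `σ - 1`
  have hG : HasDerivAt (fun s => W n (σ - 1) + ∫ u in (σ - 1)..s, (-((1 : ℝ) • W n u) + tableQ α (W n u)
      + bigLam ε₀ • tableA α (W (n - 1) u) + (bigLam ε₀)⁻¹ • tableB α (W (n + 1) u) (W n u)))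
      (-((1 : ℝ) • W n σ) + tableQ α (W n σ) + bigLam ε₀ • tableA α (W (n - 1) σ)
        + (bigLam ε₀)⁻¹ • tableB α (W (n + 1) σ) (W n σ)) σ := by
    have h := intervalIntegral.integral_hasDerivAt_right (hΦ.intervalIntegrable _ _)
      (hΦ.stronglyMeasurableAtFilter _ _) hΦ.continuousAt (a := σ - 1) (b := σ)
    exact h.const_add _
  have heq : W n =ᶠ[𝓝 σ] fun s => W n (σ - 1) + ∫ u in (σ - 1)..s, (-((1 : ℝ) • W n u) + tableQ α (W n u)
      + bigLam ε₀ • tableA α (W (n - 1) u) + (bigLam ε₀)⁻¹ • tableB α (W (n + 1) u) (W n u)) := by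
    filter_upwards [Ici_mem_nhds (show σ - 1 < σ by linarith)] with s hs
    rw [hint (σ - 1) s hs]
    abel
  exact hG.congr_of_eventuallyEq heq



end BlowupRigidityOne

end Summit.NavierStokesRegularity.NavierStokesRegularity.Theorems

end
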